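import Summits.CriticalPhenomena.PercolationContinuityZ3.Theorems.PercNearOneGluingNoHeavyQuantGateStepNFree
import Summits.CriticalPhenomena.PercolationContinuityZ3.Theorems.PercNearOneGluingNoHeavyQuantSliceSmallLayers
import HarnessLib

/-!
# QUANT lane R8, T-DEC: FOREST DATA AT THE LAW LEVEL — sibling records `LawDec.Sib`, the forest law `flaw` of a sibling list and its
# functionals (`ftop`, `fmean`, `sigmaR`, `sigmaM`, `qmin`); linearity of `lconv` over finite sums; a gated law is the mixture of its gated atoms

builds on p205010 (kernel theorem, internal audit signed; external expert review pending)

Support + definition file (`--supports stmt-CriticalPhenomena-4575`), QUANT lane typer seat prim-quant-stmt (gen 39), rung R8 of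
`run/shared/lean/prim/quant/LADDER.md`.  Definitions (a data record and list functionals — the DATA-LEVEL BINDER for forests of gated trees
that k-general certificate families need; INBOX 2026-08-25T08:55Z "the k-general form wants the TreeBuiltN binder") and elementary lemmas;
standard axioms, no sorries.  Consumers: typer g39's `…QuantAtomicRegating` (arm-1 g46's atomic re-gating identity, k-general) and
`…QuantForestBridge` (`CompForestN ↔ List Sib`, after the `…QuantSiblingStep` olean).

* tools: `lconv_fsum_left/right` (linearity of `lconv` over finite sums), `gate_eq_sum_atoms` (`gate ρ q = Σ_a ρ a · gate δ_a q`),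
  `lconv_top_right_of_le` (top truncation);
* `LawDec.Sib` (fields `q x₁ n M ρ`: root gate, sub-forest floor, gate count, top, sub-forest law), `Sib.LawOK` (`0 < q < 1`, `ρ` a probability
  law on `{0..M}`), `Sib.r` (least charged atom, `sInf {h | ρ h ≠ 0}`), `Sib.mean`, with `r_le`, `r_charged`, `one_le_r` (root relay ⇒
  `1 ≤ r ≤ M`), `r_le_mean`;
* `ftop`, **`flaw`** (`flaw (s :: L) = flaw L ∗ gate s.ρ s.q`, `flaw [] = δ₀`), `fmean` (`Σ qᵢ·mean ρᵢ`), `sigmaR` (`Σ qᵢ rᵢ`), `sigmaM` (`Σ qᵢ Mᵢ`),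
  `qmin`; `qmin_facts`, `sigmaR_facts` (`0 ≤ sigmaR ≤ fmean`, `> 0` for nonempty lists with root relays), `flaw_facts` (nonnegative, vanishing above
  `ftop`, mass `1`, mean `fmean`).

HONEST STATUS: bookkeeping only; `SiblingStep`, `GateStepN`, `FarTreeRow` OPEN; RATE class log\* / honest sentence unchanged.
[this work].  Nothing here is cited as a published result.  The gluing rows served [cite: KozmaNitzan2024, Conjecture 3 (p. 15)]; product
measure [cite: Grimmett1999, §1.3 p. 10].
-/

noncomputable section

open scoped BigOperators

namespace Summit.CriticalPhenomena.PercolationContinuityZ3.Theorems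
namespace Quant
namespace LawDec

open Finset

/-! ### Tools: linearity of `lconv` over finite sums, atoms of a gate, top truncation -/

/-- `lconv` is linear in its first argument over a finite sum. [this work] -/
theorem lconv_fsum_left {ι : Type*} (s : Finset ι) (M₁ M₂ : ℕ) (c : ι → ℝ) (μ : ι → ℕ → ℝ) (ν : ℕ → ℝ) (h : ℕ) :
    lconv M₁ M₂ (fun k => ∑ i ∈ s, c i * μ i k) ν h = ∑ i ∈ s, c i * lconv M₁ M₂ (μ i) ν h := by
  classical
  induction s using Finset.induction_on with
  | empty =>
    simp only [Finset.sum_empty]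
    simp [lconv]
  | @insert i₀ s hi ih =>
    simp only [Finset.sum_insert hi]
    have e : (fun k => c i₀ * μ i₀ k + ∑ i ∈ s, c i * μ i k) = fun k => c i₀ * μ i₀ k + 1 * (∑ i ∈ s, c i * μ i k) := by
      funext k; ring
    rw [e, lconv_lin_left, ih, one_mul]

/-- `lconv` is linear in its second argument over a finite sum. [this work] -/
theorem lconv_fsum_right {ι : Type*} (s : Finset ι) (M₁ M₂ : ℕ) (c : ι → ℝ) (μ : ℕ → ℝ) (ν : ι → ℕ → ℝ) (h : ℕ) :
    lconv M₁ M₂ μ (fun k => ∑ i ∈ s, c i * ν i k) h = ∑ i ∈ s, c i * lconv M₁ M₂ μ (ν i) h := by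
  rw [lconv_comm, lconv_fsum_left]
  exact Finset.sum_congr rfl fun i _ => by rw [lconv_comm]

/-- **a gated law is the mixture of its gated atoms**: `gate ρ q = Σ_{a ≤ M} ρ a · gate δ_a q` (mass `1`, vanishing above `M`). [this work] -/
theorem gate_eq_sum_atoms (M : ℕ) (ρ : ℕ → ℝ) (q : ℝ) (hρM : ∀ h, M < h → ρ h = 0)
    (hρ1 : ∑ h ∈ Finset.range (M + 1), ρ h = 1) (k : ℕ) :
    gate ρ q k = ∑ a ∈ Finset.range (M + 1), ρ a * gate (fun h => if h = a then (1 : ℝ) else 0) q k := by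
  have e : ∀ a, ρ a * gate (fun h => if h = a then (1 : ℝ) else 0) q k
      = q * (if k = a then ρ a else 0) + ((1 - q) * (if k = 0 then (1 : ℝ) else 0)) * ρ a := by
    intro a; simp only [LawDec.gate]; split_ifs <;> ring
  rw [Finset.sum_congr rfl fun a _ => e a, Finset.sum_add_distrib, ← Finset.mul_sum, ← Finset.mul_sum, hρ1,
    Finset.sum_ite_eq (Finset.range (M + 1)) k ρ, gate_apply]
  by_cases hk : k ∈ Finset.range (M + 1)
  · rw [if_pos hk]; ring
  · rw [if_neg hk, hρM k (by rw [Finset.mem_range] at hk; omega)]; ring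

/-- top truncation on the right: if `ν` vanishes above `M₂ ≤ M₂'`, the right top index of `lconv` may be lowered. [this work] -/
theorem lconv_top_right_of_le (M₁ M₂ M₂' : ℕ) (μ ν : ℕ → ℝ) (hM : M₂ ≤ M₂') (hνM : ∀ h, M₂ < h → ν h = 0) (h : ℕ) :
    lconv M₁ M₂' μ ν h = lconv M₁ M₂ μ ν h := by
  simp only [lconv]
  refine Finset.sum_congr rfl fun i _ => ?_
  symm
  apply Finset.sum_subset (Finset.range_mono (by omega))
  intro k hk hk'
  rw [Finset.mem_range] at hk hk'
  rw [hνM k (by omega)]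
  split_ifs <;> ring

/-! ### Sibling data and the forest functionals -/

/-- **Sibling data**: a gated tree `gate ρ q` given by its root gate `q`, its sub-forest law `ρ` on `{0..M}`, and (for the tree-built layer)
the sub-forest's floor `x₁` and gate count `n`. [this work] -/
structure Sib where
  /-- root gate -/
  q : ℝ
  /-- floor of the sub-forest (tree-built layer; unused at the law level) -/
  x₁ : ℝ
  /-- number of nontrivial gates of the sub-forest (tree-built layer; unused at the law level) -/
  n : ℕ
  /-- top of the sub-forest law -/
  M : ℕ
  /-- the sub-forest count law -/
  ρ : ℕ → ℝ

/-- law-level validity of sibling data: `0 < q < 1`, `ρ` a probability law on `{0..M}`. [this work] -/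
def Sib.LawOK (s : Sib) : Prop :=
  0 < s.q ∧ s.q < 1 ∧ (∀ h, 0 ≤ s.ρ h) ∧ (∀ h, s.M < h → s.ρ h = 0) ∧ ∑ h ∈ Finset.range (s.M + 1), s.ρ h = 1

/-- the least charged atom of the sub-forest law (`0` if there is none). [this work] -/
def Sib.r (s : Sib) : ℕ := sInf {h : ℕ | s.ρ h ≠ 0}

/-- the mean of the sub-forest law. [this work] -/
def Sib.mean (s : Sib) : ℝ := ∑ h ∈ Finset.range (s.M + 1), (h : ℝ) * s.ρ h

/-- top of the forest law of a sibling list. [this work] -/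
def ftop : List Sib → ℕ
  | [] => 0
  | s :: L => ftop L + s.M

/-- **the forest law** of a sibling list: `δ₀` convolved with the gated trees `gate sᵢ.ρ sᵢ.q`. [this work] -/
def flaw : List Sib → ℕ → ℝ
  | [] => fun h => if h = 0 then (1 : ℝ) else 0
  | s :: L => lconv (ftop L) s.M (flaw L) (gate s.ρ s.q)

/-- mean of the forest law: `Σ qᵢ·mean ρᵢ`. [this work] -/
def fmean : List Sib → ℝ
  | [] => 0
  | s :: L => fmean L + s.q * s.mean

/-- `sigmaR = Σ qᵢ·rᵢ` (the least component mean of the atomic mixture). [this work] -/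
def sigmaR : List Sib → ℝ
  | [] => 0
  | s :: L => sigmaR L + s.q * (s.r : ℝ)

/-- `sigmaM = Σ qᵢ·Mᵢ` (the largest component mean of the atomic mixture). [this work] -/
def sigmaM : List Sib → ℝ
  | [] => 0
  | s :: L => sigmaM L + s.q * (s.M : ℝ)

/-- the least root gate (`1` for the empty list). [this work] -/
def qmin : List Sib → ℝ
  | [] => 1
  | s :: L => min s.q (qmin L)

/-- the least charged atom is at most any charged atom. [this work] -/
theorem Sib.r_le (s : Sib) {h : ℕ} (hh : s.ρ h ≠ 0) : s.r ≤ h := Nat.sInf_le hh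

/-- the least charged atom is charged (mass `1`). [this work] -/
theorem Sib.r_charged (s : Sib) (hs : s.LawOK) : s.ρ s.r ≠ 0 := by
  obtain ⟨_, _, _, _, h1⟩ := hs
  have hne : {h : ℕ | s.ρ h ≠ 0}.Nonempty := by
    by_contra hemp
    rw [Set.not_nonempty_iff_eq_empty] at hemp
    have hz : ∑ h ∈ Finset.range (s.M + 1), s.ρ h = 0 :=
      Finset.sum_eq_zero fun h _ => by
        by_contra hh
        have hmem : h ∈ ({h : ℕ | s.ρ h ≠ 0} : Set ℕ) := hh
        rw [hemp] at hmem
        exact (Set.mem_empty_iff_false h).1 hmem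
    rw [h1] at hz; exact one_ne_zero hz
  exact Nat.sInf_mem hne

/-- with a root relay (`ρ 0 = 0`) the least charged atom is `≥ 1` and `≤ M`. [this work] -/
theorem Sib.one_le_r (s : Sib) (hs : s.LawOK) (h0 : s.ρ 0 = 0) : 1 ≤ s.r ∧ s.r ≤ s.M := by
  have hc := s.r_charged hs
  refine ⟨Nat.one_le_iff_ne_zero.2 fun hr => hc (by rw [hr]; exact h0), ?_⟩
  by_contra hlt
  exact hc (hs.2.2.2.1 _ (not_le.1 hlt))

/-- the least charged atom is at most the mean. [this work] -/
theorem Sib.r_le_mean (s : Sib) (hs : s.LawOK) : (s.r : ℝ) ≤ s.mean := by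
  obtain ⟨_, _, ρ0, _, ρ1⟩ := hs
  have hle : ∀ h ∈ Finset.range (s.M + 1), (s.r : ℝ) * s.ρ h ≤ (h : ℝ) * s.ρ h := by
    intro h _
    by_cases hh : s.ρ h = 0
    · rw [hh]; simp
    · exact mul_le_mul_of_nonneg_right (by exact_mod_cast s.r_le hh) (ρ0 h)
  calc (s.r : ℝ) = ∑ h ∈ Finset.range (s.M + 1), (s.r : ℝ) * s.ρ h := by rw [← Finset.mul_sum, ρ1, mul_one]
    _ ≤ s.mean := Finset.sum_le_sum hle

/-- `qmin` is positive, at most `1` and at most every root gate; `< 1` for a nonempty list. [this work] -/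
theorem qmin_facts (L : List Sib) (hL : ∀ s ∈ L, s.LawOK) :
    0 < qmin L ∧ qmin L ≤ 1 ∧ (∀ s ∈ L, qmin L ≤ s.q) ∧ (L ≠ [] → qmin L < 1) := by
  induction L with
  | nil => simp [qmin]
  | cons s L ih =>
    have hs := hL s List.mem_cons_self
    obtain ⟨ih0, ih1, ihle, _⟩ := ih (fun t ht => hL t (List.mem_cons_of_mem s ht))
    refine ⟨lt_min hs.1 ih0, (min_le_right _ _).trans ih1, fun t ht => ?_, fun _ => (min_le_left _ _).trans_lt hs.2.1⟩
    rcases List.mem_cons.1 ht with rfl | ht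
    · exact min_le_left _ _
    · exact (min_le_right _ _).trans (ihle t ht)

/-- `0 ≤ sigmaR ≤ fmean`, and `0 < sigmaR` for a nonempty list with root relays. [this work] -/
theorem sigmaR_facts (L : List Sib) (hL : ∀ s ∈ L, s.LawOK) (h0 : ∀ s ∈ L, s.ρ 0 = 0) :
    0 ≤ sigmaR L ∧ sigmaR L ≤ fmean L ∧ (L ≠ [] → 0 < sigmaR L) := by
  induction L with
  | nil => simp [sigmaR, fmean]
  | cons s L ih =>
    have hs := hL s List.mem_cons_self
    obtain ⟨ih0, ih1, _⟩ := ih (fun t ht => hL t (List.mem_cons_of_mem s ht)) (fun t ht => h0 t (List.mem_cons_of_mem s ht))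
    have hr := s.one_le_r hs (h0 s List.mem_cons_self)
    have h1 : 0 < s.q * (s.r : ℝ) := mul_pos hs.1 (by exact_mod_cast hr.1)
    have h2 : s.q * (s.r : ℝ) ≤ s.q * s.mean := mul_le_mul_of_nonneg_left (s.r_le_mean hs) hs.1.le
    simp only [sigmaR, fmean]
    exact ⟨by linarith, by linarith, fun _ => by linarith⟩

/-- facts of the forest law: nonnegative, vanishing above `ftop`, mass `1`, mean `fmean`. [this work] -/
theorem flaw_facts (L : List Sib) (hL : ∀ s ∈ L, s.LawOK) :
    (∀ h, 0 ≤ flaw L h) ∧ (∀ h, ftop L < h → flaw L h = 0) ∧ (∑ h ∈ Finset.range (ftop L + 1), flaw L h = 1) ∧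
      ∑ h ∈ Finset.range (ftop L + 1), (h : ℝ) * flaw L h = fmean L := by
  induction L with
  | nil =>
    refine ⟨fun h => ?_, fun h hh => ?_, by simp [flaw, ftop], by simp [flaw, ftop, fmean]⟩
    · simp only [flaw]; split_ifs <;> norm_num
    · simp only [flaw, ftop] at hh ⊢; rw [if_neg (by omega)]
  | cons s L ih =>
    have hs := hL s List.mem_cons_self
    obtain ⟨hq0, hq1, ρ0, ρM, ρ1⟩ := hs
    obtain ⟨f0, fM, f1, fmn⟩ := ih (fun t ht => hL t (List.mem_cons_of_mem s ht))
    have g0 : ∀ h, 0 ≤ gate s.ρ s.q h := by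
      intro h; simp only [LawDec.gate]; split_ifs <;> nlinarith [ρ0 h]
    have g1 : ∑ h ∈ Finset.range (s.M + 1), gate s.ρ s.q h = 1 := sum_gate s.ρ s.q s.M ρ1
    refine ⟨?_, ?_, ?_, ?_⟩
    · intro h; simp only [flaw]; exact lconv_nonneg _ _ _ _ f0 g0 h
    · intro h hh; simp only [flaw, ftop] at hh ⊢; exact lconv_eq_zero _ _ _ _ h (by omega)
    · simp only [flaw, ftop]; exact sum_lconv _ _ _ _ f1 g1
    · simp only [flaw, ftop, fmean]
      rw [sum_mul_lconv _ _ _ _ f1 g1, fmn, sum_mul_gate]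
      rfl

end LawDec
end Quant
end Summit.CriticalPhenomena.PercolationContinuityZ3.Theorems
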